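import Mathlib
import Literature.Analysis.OperatorTheory.ContractiveDetComplexity
import Literature.Analysis.OperatorTheory.ContractiveDeterminantalRepresentations
import HarnessLib

/-!
# Crux `PriceOfContractivity` (stmt-ValiantsHypothesis-10583), line `registered` (birth rev 8) —
# stub `stub_normHalvingRescale` (norm halving at ONE scale implies norm halving at EVERY scale)

Route `ValiantsHypothesis/ContractivityPrice`, crux K1
(`Summit.ValiantsHypothesis.ValiantsHypothesis.Theses.ContractivityPrice.PriceOfContractivity`).
Every realization is written as a Sylvester pencil
`1 + Matrix.diagonal (fun i => X (κ i)) * K.map C` (size `R`, colouring `κ : Fin R → σ`,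
matrix `K : Matrix (Fin R) (Fin R) ℂ`).  The norm-halving hypothesis NH₁ of the lead's skeleton says:
a pencil with `‖K‖_op ≤ 2` whose determinant has no zero on the closed polydisc of radius `2` is
re-realized with `‖K'‖_op ≤ 1` at a size factor quasi-polynomial in `n` (a bound on the number of
variables and on the total degree), for inputs of size `R` in a quasi-polynomial domain.  This file
proves the registered glue stub `stub_normHalvingRescale`: NH₁ implies the same statement at an
arbitrary norm scale `M ≥ 1` (`‖K‖_op ≤ 2M ⟹ ‖K'‖_op ≤ M`, same constant `c`, same domain).

Proof (rescaling `x ↦ x / M`).  Put `t := M⁻¹` and `K₀ := t • K`, so `‖K₀‖ = M⁻¹ ‖K‖ ≤ 2`.  The key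
identity `det (1 + diag (X ∘ κ) (s • K)) = φ_s (det (1 + diag (X ∘ κ) K))` with the algebra map
`φ_s : X_j ↦ C s * X_j` (`det_pencil_smul`) shows that the pencil determinant of `K₀` is the
rescaled pencil determinant of `K`: its total degree does not grow (`φ_s` substitutes affine forms)
and it has no zero on the closed radius-`2` polydisc (`eval z ∘ φ_t = eval (t z)` and `‖t z_j‖ ≤ 2`
as `M ≥ 1`).  NH₁ re-realizes it by `K''`, `κ''` with `‖K''‖ ≤ 1`; then `K' := M • K''` has
`‖K'‖ ≤ M` and, by the key identity at `s = M` twice and `M • M⁻¹ • K = K`, the pencil determinant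
of `K'` (colouring `κ''`) is that of `K` (colouring `κ`).

No definitions; pure theorem file serving the lead's skeleton `work/PriceOfContractivity.lean`.
References: folklore (rescaling of a linear pencil); Mathlib's `MvPolynomial.bind₁` API.
-/

noncomputable section

-- `Summit.<Summit>.<Problem>` repeats `ValiantsHypothesis` by the tree's layout convention (D-0017).
set_option linter.dupNamespace false

namespace Summit.ValiantsHypothesis.ValiantsHypothesis.Theorems.PriceOfContractivity.NormHalvingRescale

open Matrix MvPolynomial

/-! ### The rescaling substitution `x ↦ s • x` -/

/-- Rescaling the variables does not increase the total degree (the substituted forms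
`C s * X j` are affine). [folklore]
-- adapted from Literature.Computability.AlgebraicComplexity.DefinableVNPWitness.totalDegree_bind₁_le -/
theorem totalDegree_rescale_le {σ : Type*} (s : ℂ) (p : MvPolynomial σ ℂ) :
    (bind₁ (fun j : σ => C s * X j) p).totalDegree ≤ p.totalDegree := by
  classical
  have hh : ∀ j : σ, (C s * X j : MvPolynomial σ ℂ).totalDegree ≤ 1 := fun j =>
    (totalDegree_mul _ _).trans (by rw [totalDegree_C, totalDegree_X, zero_add])
  conv_lhs => rw [p.as_sum, map_sum]
  refine (totalDegree_finsetSum _ _).trans (Finset.sup_le fun m hm => ?_)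
  rw [bind₁_monomial]
  refine (totalDegree_mul _ _).trans ?_
  rw [totalDegree_C, zero_add]
  refine (totalDegree_finsetProd _ _).trans ?_
  calc ∑ v ∈ m.support, ((C s * X v : MvPolynomial σ ℂ) ^ m v).totalDegree
      ≤ ∑ v ∈ m.support, m v := Finset.sum_le_sum fun v _ =>
        (totalDegree_pow _ _).trans (by have := hh v; nlinarith)
    _ = m.sum fun _ e => e := rfl
    _ ≤ p.totalDegree := le_totalDegree hm

/-- Evaluating a rescaled polynomial: `(φ_s p) (z) = p (s z)`. [folklore] -/
theorem eval_rescale {σ : Type*} (s : ℂ) (p : MvPolynomial σ ℂ) (z : σ → ℂ) :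
    eval z (bind₁ (fun j : σ => C s * X j) p) = eval (fun j => s * z j) p := by
  show eval₂Hom (RingHom.id ℂ) z (bind₁ _ p) = eval₂Hom (RingHom.id ℂ) _ p
  rw [eval₂Hom_bind₁]
  refine congrArg (fun g : σ → ℂ => eval₂Hom (RingHom.id ℂ) g p) (funext fun j => ?_)
  simp

/-- **Key lemma (rescaling a Sylvester pencil).** Scaling the matrix by `s` is the substitution
`x ↦ s x` in the pencil determinant:
`det (1 + diag (X ∘ κ) (s • K)) = φ_s (det (1 + diag (X ∘ κ) K))`, `φ_s : X_j ↦ C s * X_j`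
(apply the algebra map `φ_s` entrywise: `φ_s (X (κ i) * C (K i j)) = X (κ i) * C (s * K i j)`).
[folklore] -/
theorem det_pencil_smul {R : ℕ} {σ : Type} (s : ℂ) (K : Matrix (Fin R) (Fin R) ℂ) (κ : Fin R → σ) :
    (1 + Matrix.diagonal (fun i => MvPolynomial.X (κ i)) *
        (s • K).map (fun a : ℂ => (MvPolynomial.C a : MvPolynomial σ ℂ))).det =
      MvPolynomial.bind₁ (fun j : σ => MvPolynomial.C s * MvPolynomial.X j)
        (1 + Matrix.diagonal (fun i => MvPolynomial.X (κ i)) *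
          K.map (fun a : ℂ => (MvPolynomial.C a : MvPolynomial σ ℂ))).det := by
  rw [AlgHom.map_det, map_add, map_one, map_mul, AlgHom.mapMatrix_apply, AlgHom.mapMatrix_apply,
    diagonal_map (map_zero _), Matrix.map_map]
  congr 1
  ext i j
  simp only [Matrix.add_apply, Matrix.diagonal_mul, Matrix.map_apply, Matrix.smul_apply,
    Function.comp_apply, bind₁_X_right, bind₁_C_right, smul_eq_mul, map_mul]
  ring

/-! ### The stub -/

/-- **Stub `stub_normHalvingRescale` (rescaling glue): NH₁ ⟹ NH at every scale `M ≥ 1`.**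
Given `‖K‖ ≤ 2M`, the pencil of `M⁻¹ K` is the image of the pencil of `K` under the algebra map
`x_j ↦ M⁻¹ x_j` (total degree does not grow, zero-free on the closed radius-2 polydisc because
`‖z / M‖ ≤ 2`), NH₁ re-realizes it with `‖K''‖ ≤ 1`, and the inverse map `x_j ↦ M x_j` turns that
into the realization `M K''` of the original pencil with `‖M K''‖ ≤ M`. [folklore] -/
theorem stub_normHalvingRescale :
    (∃ c : ℕ, ∀ (n R : ℕ) {σ : Type} [Fintype σ] (K : Matrix (Fin R) (Fin R) ℂ) (κ : Fin R → σ),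
      R ≤ 2 ^ ((Nat.log 2 n + c + 2) ^ (c + 2)) →
      Fintype.card σ ≤ n →
      (1 + Matrix.diagonal (fun i => MvPolynomial.X (κ i)) * K.map (fun a : ℂ => (MvPolynomial.C a : MvPolynomial σ ℂ))).det.totalDegree ≤ n →
      ‖Matrix.toEuclideanCLM (𝕜 := ℂ) K‖ ≤ 2 →
      (∀ z : σ → ℂ, (∀ j, ‖z j‖ ≤ 2) → MvPolynomial.eval z (1 + Matrix.diagonal (fun i => MvPolynomial.X (κ i)) * K.map (fun a : ℂ => (MvPolynomial.C a : MvPolynomial σ ℂ))).det ≠ 0) →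
      ∃ R' ≤ 2 ^ ((Nat.log 2 n + c) ^ c) * R, ∃ (K' : Matrix (Fin R') (Fin R') ℂ) (κ' : Fin R' → σ),
        ‖Matrix.toEuclideanCLM (𝕜 := ℂ) K'‖ ≤ 1 ∧
        (1 + Matrix.diagonal (fun i => MvPolynomial.X (κ i)) * K.map (fun a : ℂ => (MvPolynomial.C a : MvPolynomial σ ℂ))).det =
          (1 + Matrix.diagonal (fun i => MvPolynomial.X (κ' i)) * K'.map (fun a : ℂ => (MvPolynomial.C a : MvPolynomial σ ℂ))).det) →
    ∃ c : ℕ, ∀ (n R : ℕ) (M : ℝ) {σ : Type} [Fintype σ] (K : Matrix (Fin R) (Fin R) ℂ) (κ : Fin R → σ),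
      R ≤ 2 ^ ((Nat.log 2 n + c + 2) ^ (c + 2)) →
      Fintype.card σ ≤ n →
      (1 + Matrix.diagonal (fun i => MvPolynomial.X (κ i)) * K.map (fun a : ℂ => (MvPolynomial.C a : MvPolynomial σ ℂ))).det.totalDegree ≤ n →
      1 ≤ M →
      ‖Matrix.toEuclideanCLM (𝕜 := ℂ) K‖ ≤ 2 * M →
      (∀ z : σ → ℂ, (∀ j, ‖z j‖ ≤ 2) → MvPolynomial.eval z (1 + Matrix.diagonal (fun i => MvPolynomial.X (κ i)) * K.map (fun a : ℂ => (MvPolynomial.C a : MvPolynomial σ ℂ))).det ≠ 0) →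
      ∃ R' ≤ 2 ^ ((Nat.log 2 n + c) ^ c) * R, ∃ (K' : Matrix (Fin R') (Fin R') ℂ) (κ' : Fin R' → σ),
        ‖Matrix.toEuclideanCLM (𝕜 := ℂ) K'‖ ≤ M ∧
        (1 + Matrix.diagonal (fun i => MvPolynomial.X (κ i)) * K.map (fun a : ℂ => (MvPolynomial.C a : MvPolynomial σ ℂ))).det =
          (1 + Matrix.diagonal (fun i => MvPolynomial.X (κ' i)) * K'.map (fun a : ℂ => (MvPolynomial.C a : MvPolynomial σ ℂ))).det := by
  rintro ⟨c, hc⟩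
  refine ⟨c, fun n R M σ _ K κ hR hσ hdeg hM hK hz => ?_⟩
  -- the two scale factors `M` and `t = M⁻¹`
  have hM0 : (0 : ℝ) < M := one_pos.trans_le hM
  have hMC : (M : ℂ) ≠ 0 := Complex.ofReal_ne_zero.mpr hM0.ne'
  have hnM : ‖(M : ℂ)‖ = M := by rw [Complex.norm_real, Real.norm_of_nonneg hM0.le]
  obtain ⟨t, ht⟩ : ∃ t : ℂ, t = (M : ℂ)⁻¹ := ⟨_, rfl⟩
  have hnt : ‖t‖ = M⁻¹ := by rw [ht, norm_inv, hnM]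
  have ht1 : ‖t‖ ≤ 1 := by rw [hnt]; exact inv_le_one_of_one_le₀ hM
  have hMt : (M : ℂ) * t = 1 := by rw [ht]; exact mul_inv_cancel₀ hMC
  -- the hypotheses of NH₁ for `K₀ := t • K`
  have hdeg₀ : (1 + Matrix.diagonal (fun i => MvPolynomial.X (κ i)) *
      (t • K).map (fun a : ℂ => (MvPolynomial.C a : MvPolynomial σ ℂ))).det.totalDegree ≤ n := by
    rw [det_pencil_smul]
    exact (totalDegree_rescale_le _ _).trans hdeg
  have hK₀ : ‖Matrix.toEuclideanCLM (𝕜 := ℂ) (t • K)‖ ≤ 2 := by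
    rw [map_smul, norm_smul, hnt]
    calc M⁻¹ * ‖Matrix.toEuclideanCLM (𝕜 := ℂ) K‖ ≤ M⁻¹ * (2 * M) := by gcongr
      _ = 2 := by field_simp
  have hz₀ : ∀ z : σ → ℂ, (∀ j, ‖z j‖ ≤ 2) →
      MvPolynomial.eval z (1 + Matrix.diagonal (fun i => MvPolynomial.X (κ i)) *
        (t • K).map (fun a : ℂ => (MvPolynomial.C a : MvPolynomial σ ℂ))).det ≠ 0 := by
    intro z hz2
    rw [det_pencil_smul, eval_rescale]
    refine hz _ fun j => ?_
    rw [norm_mul]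
    calc ‖t‖ * ‖z j‖ ≤ 1 * 2 := mul_le_mul ht1 (hz2 j) (norm_nonneg _) zero_le_one
      _ = 2 := one_mul _
  -- apply NH₁ and scale back
  obtain ⟨R', hR', K'', κ'', hK'', hdet⟩ := hc n R (t • K) κ hR hσ hdeg₀ hK₀ hz₀
  refine ⟨R', hR', (M : ℂ) • K'', κ'', ?_, ?_⟩
  · rw [map_smul, norm_smul, hnM]
    calc M * ‖Matrix.toEuclideanCLM (𝕜 := ℂ) K''‖ ≤ M * 1 := by gcongr
      _ = M := mul_one _
  · rw [det_pencil_smul (M : ℂ) K'' κ'', ← hdet, ← det_pencil_smul (M : ℂ) (t • K) κ, smul_smul, hMt,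
      one_smul]

end Summit.ValiantsHypothesis.ValiantsHypothesis.Theorems.PriceOfContractivity.NormHalvingRescale

end
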